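import Summits.CriticalPhenomena.PercolationContinuityZ3.Theorems.PercNearOneGluingNoHeavyQuantSliceHeavy
import Summits.CriticalPhenomena.PercolationContinuityZ3.Theorems.PercNearOneGluingNoHeavyQuantLawDecFlowsDecomposition
import HarnessLib

/-!
# QUANT lane R8, T-DEC: HEAVY FLOWS — the flow form of heavy DEC, and criterion E / heavy flows give DEC SLICES (Conjecture SL's conclusion
# with one hypothesis for every law certified by giant absorption or by an all-heavy flow)

builds on p205010 (kernel theorem, internal audit signed; external expert review pending)

Statement + support file (`--supports stmt-CriticalPhenomena-4575`), QUANT lane typer seat prim-quant-stmt (gen 22), rung R8 of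
`run/shared/lean/prim/quant/LADDER.md`.  One `Prop` (`LawDec.HFlowAtT` = `FlowAtT` whose used mid pairs have `pairGate ≥ x`), theorems with
standard axioms, no sorries.  Continues `…QuantLawDecFlows(Decomposition)` (typer g22: `FlowAtT`, `decAtT_of_flowAtT`) and `…QuantSliceHeavy`
(typer g22: `HDECAtT`, `slice_decAtT_of_hdecAtT`).

* `LawDec.HFlowAtT x T j′ M μ` — flows as in `FlowAtT` plus: a used MID pair `(l, h)` (`h ≤ j′`) has `x ≤ pairGate x T l h` (its minimal gate is heavy).
* **`LawDec.hdecAtT_of_hflowAtT`** — a heavy flow yields a heavy DEC datum (the construction of `decAtT_of_flowAtT`; the mid components sit at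
  their minimal gates `pairGate ≥ x`, credit `2l + (h−l)·pairGate ≥ T` because `pairGate ≥ ρ`).
* **`LawDec.hflowAtT_of_giantsAbsorbLows`** — CRITERION E AS A HEAVY FLOW: if `x·P(low) ≤ (1−x)·P(giant)` (lows `l ≤ j′`, `2l < T`; giants
  `j′ < h ≤ M`), the proportional flow `f l h = μ l·μ h/P_G` into the giants is a heavy flow (no mid pair used).
* **`LawDec.slice_decAtT_of_hflowAtT`**, **`LawDec.slice_decAtT_of_giantsAbsorbLows`** — hence the slice of such a law by any blob
  `(a ≥ 1, x ≤ g ≤ 1)` is DEC(j′) at target `T + a·g` (`slice_decAtT_of_hdecAtT`): Conjecture SL's conclusion from the layer-`j′` data alone for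
  the E-certified bulk of the census (DEC-TAMP-G50 §3.7: criterion E alone certifies 75–99 % of tree/blob instances).

[this work]; DEC rules ARCH-TREES-G49 §2.2 / DEC-TAMP-G50 §3.1/§3.7, DEC-CLOSURE-G53 §3.2 (this lane).  The gluing rows served
[cite: KozmaNitzan2024, Conjecture 3 (p. 15)]; product measure [cite: Grimmett1999, §1.3 p. 10].
-/

noncomputable section

namespace Summit.CriticalPhenomena.PercolationContinuityZ3.Theorems

namespace Quant

open Finset

/-- the two-point law `{lo, hi; g}` (as in `…QuantLawDEC`) -/
local notation3 "TP[" lo ", " hi ", " g ", " h "]" =>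
  (g : ℝ) * (if (h : ℕ) = (hi : ℕ) then (1 : ℝ) else 0) + (1 - (g : ℝ)) * (if (h : ℕ) = (lo : ℕ) then (1 : ℝ) else 0)

namespace LawDec

/-- **HEAVY FLOW FORM**: `FlowAtT` whose used mid pairs (`h ≤ j′`) have a heavy minimal gate `x ≤ pairGate x T l h`. [this work] -/
def HFlowAtT (x T : ℝ) (j' M : ℕ) (μ : ℕ → ℝ) : Prop :=
  ∃ f : ℕ → ℕ → ℝ,
    (∀ l h, 0 ≤ f l h) ∧
    (∀ l h, 0 < f l h → l ≤ j' ∧ 2 * (l : ℝ) < T ∧ h ≤ M ∧ (j' + 1 ≤ h ∨ T < (l : ℝ) + h)) ∧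
    (∀ l, l ≤ j' → 2 * (l : ℝ) < T → ∑ h ∈ Finset.range (M + 1), f l h = μ l) ∧
    (∀ h, h ≤ M → (j' + 1 ≤ h ∨ T ≤ 2 * (h : ℝ)) → ∑ l ∈ Finset.range (j' + 1), usage x T j' l h * f l h ≤ μ h) ∧
    (∀ l h, 0 < f l h → ¬ (j' + 1 ≤ h) → x ≤ pairGate x T l h)

/-- a heavy flow is a flow. [this work] -/
theorem HFlowAtT.flowAtT {x T : ℝ} {j' M : ℕ} {μ : ℕ → ℝ} (h : HFlowAtT x T j' M μ) : FlowAtT x T j' M μ := by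
  obtain ⟨f, h0, hs, hl, hc, _⟩ := h
  exact ⟨f, h0, hs, hl, hc⟩

/-- **A HEAVY FLOW ⟹ HEAVY DEC(j′) AT TARGET `T`** for a law `μ` on `{0..M}` of mass `1` (`0 < x < 1`): the construction of
`LawDec.decAtT_of_flowAtT` (pairs at their minimal gates, leftover mass as self-sufficient points) produces no light credit pair when every
used mid pair has `pairGate ≥ x`. [this work] -/
theorem hdecAtT_of_hflowAtT (x T : ℝ) (j' M : ℕ) (μ : ℕ → ℝ) (hx0 : 0 < x) (hx1 : x < 1)
    (hμM : ∀ h, M < h → μ h = 0) (hμ1 : ∑ h ∈ Finset.range (M + 1), μ h = 1)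
    (h : HFlowAtT x T j' M μ) : HDECAtT x T j' M μ := by
  classical
  obtain ⟨f, hf0, hsupp, hlow, hcap, hheavy⟩ := h
  -- facts about used pairs
  have hpair : ∀ l h, 0 < f l h → l < h ∧ 0 < gateOf x T j' l h ∧ gateOf x T j' l h < 1 := by
    intro l h hp
    obtain ⟨hlj, hl2, _, hc⟩ := hsupp l h hp
    by_cases hgi : j' + 1 ≤ h
    · simp only [gateOf, if_pos hgi]
      exact ⟨by omega, hx0, hx1⟩
    · simp only [gateOf, if_neg hgi]
      have hc' : T < (l : ℝ) + h := hc.resolve_left hgi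
      have hlt : l < h := by
        have : (l : ℝ) < h := by linarith
        exact_mod_cast this
      exact ⟨hlt, pairGate_pos x T l h hl2 hlt, pairGate_lt_one x T l h hx0 hx1 hl2 hc'⟩
  have hf_zero : ∀ l h, ¬ (l ≤ j' ∧ 2 * (l : ℝ) < T ∧ h ≤ M ∧ (j' + 1 ≤ h ∨ T < (l : ℝ) + h)) → f l h = 0 := by
    intro l h hn
    by_contra hne
    exact hn (hsupp l h (lt_of_le_of_ne (hf0 l h) (Ne.symm hne)))
  -- no flow into a low atom, no flow out of a non-low atom
  have hin_low : ∀ l t, t ≤ j' → 2 * (t : ℝ) < T → f l t = 0 := by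
    intro l t htj ht2
    refine hf_zero l t ?_
    rintro ⟨_, hl2, _, hc⟩
    rcases hc with hc | hc
    · omega
    · linarith
  have hout_nonlow : ∀ t h, ¬ (t ≤ j' ∧ 2 * (t : ℝ) < T) → f t h = 0 := by
    intro t h hn
    exact hf_zero t h (fun hc => hn ⟨hc.1, hc.2.1⟩)
  -- the split of a pair weight into its low and high parts
  have hsplit : ∀ l h, f l h / (1 - gateOf x T j' l h) = f l h + usage x T j' l h * f l h := by
    intro l h
    rcases (hf0 l h).eq_or_lt with hz | hp
    · rw [← hz]; simp
    · have h1 : 1 - gateOf x T j' l h ≠ 0 := by linarith [(hpair l h hp).2.2]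
      simp only [usage]
      field_simp
      ring
  -- THE DECOMPOSITION
  refine ⟨(Fin (j' + 1) × Fin (M + 1)) ⊕ Fin (M + 1), inferInstance,
    Sum.elim (fun p => f p.1 p.2 / (1 - gateOf x T j' p.1 p.2))
      (fun h => if (h : ℕ) ≤ j' ∧ 2 * ((h : ℕ) : ℝ) < T then 0
        else μ h - ∑ l ∈ Finset.range (j' + 1), usage x T j' l h * f l h),
    Sum.elim (fun p => if 0 < f p.1 p.2 then gateOf x T j' p.1 p.2 else 0) (fun _ => 1),
    Sum.elim (fun p => min (p.1 : ℕ) p.2) (fun h => (h : ℕ)), Sum.elim (fun p => (p.2 : ℕ)) (fun h => (h : ℕ)),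
    ?_, ?_, ?_, ?_, ?_, ?_, ?_⟩
  · -- nonnegativity
    rintro (p | h)
    · dsimp only [Sum.elim_inl]
      rcases (hf0 p.1 p.2).eq_or_lt with hz | hp
      · rw [← hz, zero_div]
      · exact div_nonneg (hf0 _ _) (by linarith [(hpair _ _ hp).2.2])
    · dsimp only [Sum.elim_inr]
      split_ifs with hl
      · exact le_rfl
      · exact sub_nonneg.2 (hcap h (Nat.lt_succ_iff.1 h.isLt) (by
          by_cases hj : j' + 1 ≤ (h : ℕ)
          · exact Or.inl hj
          · exact Or.inr (not_lt.1 fun hlt => hl ⟨by omega, hlt⟩)))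
  · -- total weight (from the mixture identity proved below, but we prove it directly)
    rw [Fintype.sum_sum_type, Fintype.sum_prod_type]
    show (∑ p₁ : Fin (j' + 1), ∑ p₂ : Fin (M + 1), f (p₁ : ℕ) (p₂ : ℕ) / (1 - gateOf x T j' (p₁ : ℕ) (p₂ : ℕ))) +
      ∑ h : Fin (M + 1), (if (h : ℕ) ≤ j' ∧ 2 * ((h : ℕ) : ℝ) < T then 0 else
        μ h - ∑ l ∈ Finset.range (j' + 1), usage x T j' l h * f l h) = 1
    rw [Fin.sum_univ_eq_sum_range (fun l => ∑ p₂ : Fin (M + 1), f l (p₂ : ℕ) / (1 - gateOf x T j' l (p₂ : ℕ))) (j' + 1)]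
    rw [Fin.sum_univ_eq_sum_range (fun h => if h ≤ j' ∧ 2 * (h : ℝ) < T then (0 : ℝ) else
        μ h - ∑ l ∈ Finset.range (j' + 1), usage x T j' l h * f l h) (M + 1)]
    have e1 : ∀ l, (∑ p₂ : Fin (M + 1), f l (p₂ : ℕ) / (1 - gateOf x T j' l (p₂ : ℕ))) =
        ∑ h ∈ Finset.range (M + 1), f l h / (1 - gateOf x T j' l h) := fun l =>
      Fin.sum_univ_eq_sum_range (fun h => f l h / (1 - gateOf x T j' l h)) (M + 1)
    simp only [e1]
    rw [Finset.sum_congr rfl (fun l _ => Finset.sum_congr rfl (fun h _ => hsplit l h))]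
    simp only [Finset.sum_add_distrib]
    rw [Finset.sum_comm (f := fun l h => usage x T j' l h * f l h), add_assoc, ← Finset.sum_add_distrib]
    -- Σ_l Σ_h f l h = Σ_{low l ≤ j'} μ l ; Σ_h (load + point) = Σ_{non-low h ≤ M} μ h
    have eL : ∑ l ∈ Finset.range (j' + 1), ∑ h ∈ Finset.range (M + 1), f l h
        = ∑ l ∈ Finset.range (j' + 1), (if l ≤ j' ∧ 2 * (l : ℝ) < T then μ l else 0) := by
      refine Finset.sum_congr rfl fun l hl => ?_
      have hlj : l ≤ j' := Nat.lt_succ_iff.1 (Finset.mem_range.1 hl)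
      by_cases hlow' : 2 * (l : ℝ) < T
      · rw [if_pos ⟨hlj, hlow'⟩, hlow l hlj hlow']
      · rw [if_neg (fun hc => hlow' hc.2)]
        exact Finset.sum_eq_zero fun h _ => hout_nonlow l h (fun hc => hlow' hc.2)
    have eH : ∑ h ∈ Finset.range (M + 1), (∑ l ∈ Finset.range (j' + 1), usage x T j' l h * f l h +
        (if h ≤ j' ∧ 2 * (h : ℝ) < T then (0 : ℝ) else μ h - ∑ l ∈ Finset.range (j' + 1), usage x T j' l h * f l h))
        = ∑ h ∈ Finset.range (M + 1), (if h ≤ j' ∧ 2 * (h : ℝ) < T then 0 else μ h) := by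
      refine Finset.sum_congr rfl fun h _ => ?_
      by_cases hl : h ≤ j' ∧ 2 * (h : ℝ) < T
      · rw [if_pos hl, if_pos hl, add_zero]
        exact Finset.sum_eq_zero fun l _ => by rw [hin_low l h hl.1 hl.2, mul_zero]
      · rw [if_neg hl, if_neg hl]; ring
    rw [eL, eH]
    -- both index ranges can be taken to be `range (max ...)`: extend each to a common range using vanishing
    have eL' : ∑ l ∈ Finset.range (j' + 1), (if l ≤ j' ∧ 2 * (l : ℝ) < T then μ l else 0)
        = ∑ l ∈ Finset.range (M + 1), (if l ≤ j' ∧ 2 * (l : ℝ) < T then μ l else 0) := by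
      rcases le_or_gt j' M with hjM | hMj
      · rw [Finset.range_eq_Ico, Finset.range_eq_Ico,
          ← Finset.sum_Ico_consecutive _ (Nat.zero_le (j' + 1)) (by omega : j' + 1 ≤ M + 1)]
        have : ∑ l ∈ Finset.Ico (j' + 1) (M + 1), (if l ≤ j' ∧ 2 * (l : ℝ) < T then μ l else 0) = 0 :=
          Finset.sum_eq_zero fun l hl => by
            rw [Finset.mem_Ico] at hl
            rw [if_neg (fun hc => by omega)]
        rw [this, add_zero]
      · rw [Finset.range_eq_Ico, Finset.range_eq_Ico,
          ← Finset.sum_Ico_consecutive _ (Nat.zero_le (M + 1)) (by omega : M + 1 ≤ j' + 1)]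
        have : ∑ l ∈ Finset.Ico (M + 1) (j' + 1), (if l ≤ j' ∧ 2 * (l : ℝ) < T then μ l else 0) = 0 :=
          Finset.sum_eq_zero fun l hl => by
            rw [Finset.mem_Ico] at hl
            split_ifs
            · exact hμM l (by omega)
            · rfl
        rw [this, add_zero]
    rw [eL', ← Finset.sum_add_distrib, ← hμ1]
    refine Finset.sum_congr rfl fun h _ => ?_
    split_ifs <;> ring
  · -- gates in [0,1]
    rintro (p | h)
    · dsimp only [Sum.elim_inl]
      split_ifs with hp
      · exact ⟨(hpair _ _ hp).2.1.le, (hpair _ _ hp).2.2.le⟩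
      · exact ⟨le_rfl, zero_le_one⟩
    · exact ⟨zero_le_one, le_rfl⟩
  · rintro (p | h)
    · exact min_le_right _ _
    · exact le_rfl
  · rintro (p | h)
    · exact Nat.lt_succ_iff.1 p.2.isLt
    · exact Nat.lt_succ_iff.1 h.isLt
  · -- mixture identity
    intro t
    rw [Fintype.sum_sum_type, Fintype.sum_prod_type]
    show μ t =
      (∑ p₁ : Fin (j' + 1), ∑ p₂ : Fin (M + 1),
        f (p₁ : ℕ) (p₂ : ℕ) / (1 - gateOf x T j' (p₁ : ℕ) (p₂ : ℕ)) *
          TP[min (p₁ : ℕ) (p₂ : ℕ), (p₂ : ℕ), (if 0 < f (p₁ : ℕ) (p₂ : ℕ) then gateOf x T j' (p₁ : ℕ) (p₂ : ℕ) else 0), t]) +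
      ∑ h : Fin (M + 1), (if (h : ℕ) ≤ j' ∧ 2 * ((h : ℕ) : ℝ) < T then 0 else
        μ h - ∑ l ∈ Finset.range (j' + 1), usage x T j' l h * f l h) * TP[(h : ℕ), (h : ℕ), (1 : ℝ), t]
    rw [Fin.sum_univ_eq_sum_range (fun l => ∑ p₂ : Fin (M + 1),
        f l (p₂ : ℕ) / (1 - gateOf x T j' l (p₂ : ℕ)) *
          TP[min l (p₂ : ℕ), (p₂ : ℕ), (if 0 < f l (p₂ : ℕ) then gateOf x T j' l (p₂ : ℕ) else 0), t]) (j' + 1)]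
    rw [Fin.sum_univ_eq_sum_range (fun h => (if h ≤ j' ∧ 2 * (h : ℝ) < T then (0 : ℝ) else
        μ h - ∑ l ∈ Finset.range (j' + 1), usage x T j' l h * f l h) * TP[h, h, (1 : ℝ), t]) (M + 1)]
    have e1 : ∀ l, (∑ p₂ : Fin (M + 1), f l (p₂ : ℕ) / (1 - gateOf x T j' l (p₂ : ℕ)) *
          TP[min l (p₂ : ℕ), (p₂ : ℕ), (if 0 < f l (p₂ : ℕ) then gateOf x T j' l (p₂ : ℕ) else 0), t]) =
        ∑ h ∈ Finset.range (M + 1), f l h / (1 - gateOf x T j' l h) *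
          TP[min l h, h, (if 0 < f l h then gateOf x T j' l h else 0), t] := fun l =>
      Fin.sum_univ_eq_sum_range (fun h => f l h / (1 - gateOf x T j' l h) *
          TP[min l h, h, (if 0 < f l h then gateOf x T j' l h else 0), t]) (M + 1)
    simp only [e1]
    have e2 : ∀ l h, f l h / (1 - gateOf x T j' l h) * TP[min l h, h, (if 0 < f l h then gateOf x T j' l h else 0), t]
        = (usage x T j' l h * f l h) * (if t = h then (1 : ℝ) else 0) + f l h * (if t = l then (1 : ℝ) else 0) := by
      intro l h
      rcases (hf0 l h).eq_or_lt with hz | hp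
      · rw [← hz]; simp
      · rw [if_pos hp, min_eq_left (hpair l h hp).1.le]
        have h1 : 1 - gateOf x T j' l h ≠ 0 := by linarith [(hpair l h hp).2.2]
        have hk : f l h / (1 - gateOf x T j' l h) * (1 - gateOf x T j' l h) = f l h := div_mul_cancel₀ _ h1
        have hu : usage x T j' l h * f l h = gateOf x T j' l h * (f l h / (1 - gateOf x T j' l h)) := by
          simp only [usage]; field_simp
        rw [hu]
        calc f l h / (1 - gateOf x T j' l h) * TP[l, h, gateOf x T j' l h, t]
            = gateOf x T j' l h * (f l h / (1 - gateOf x T j' l h)) * (if t = h then (1 : ℝ) else 0)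
              + (f l h / (1 - gateOf x T j' l h) * (1 - gateOf x T j' l h)) * (if t = l then (1 : ℝ) else 0) := by ring
          _ = _ := by rw [hk]
    rw [Finset.sum_congr rfl (fun l _ => Finset.sum_congr rfl (fun h _ => e2 l h))]
    simp only [Finset.sum_add_distrib]
    rw [Finset.sum_comm (f := fun l h => (usage x T j' l h * f l h) * (if t = h then (1 : ℝ) else 0))]
    simp only [← Finset.sum_mul]
    rw [sum_indicator (fun h => ∑ l ∈ Finset.range (j' + 1), usage x T j' l h * f l h) (M + 1) t]
    rw [sum_indicator (fun l => ∑ h ∈ Finset.range (M + 1), f l h) (j' + 1) t]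
    have e4 : ∀ h : ℕ, (if h ≤ j' ∧ 2 * (h : ℝ) < T then (0 : ℝ) else
        μ h - ∑ l ∈ Finset.range (j' + 1), usage x T j' l h * f l h) * TP[h, h, (1 : ℝ), t]
        = (if h ≤ j' ∧ 2 * (h : ℝ) < T then (0 : ℝ) else
          μ h - ∑ l ∈ Finset.range (j' + 1), usage x T j' l h * f l h) * (if t = h then (1 : ℝ) else 0) := by
      intro h; ring
    simp only [e4]
    rw [sum_indicator (fun h => if h ≤ j' ∧ 2 * (h : ℝ) < T then (0 : ℝ) else
        μ h - ∑ l ∈ Finset.range (j' + 1), usage x T j' l h * f l h) (M + 1) t]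
    by_cases htl : t ≤ j' ∧ 2 * (t : ℝ) < T
    · -- a low atom: shipped exactly, receives nothing, no point mass
      have hrecv : ∑ l ∈ Finset.range (j' + 1), usage x T j' l t * f l t = 0 :=
        Finset.sum_eq_zero fun l _ => by rw [hin_low l t htl.1 htl.2, mul_zero]
      rw [if_pos (Nat.lt_succ_of_le htl.1), hlow t htl.1 htl.2]
      by_cases htM : t < M + 1
      · rw [if_pos htM, if_pos htM, hrecv, if_pos htl]; ring
      · rw [if_neg htM, if_neg htM]; ring
    · -- a non-low atom
      have hship : ∑ h ∈ Finset.range (M + 1), f t h = 0 :=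
        Finset.sum_eq_zero fun h _ => hout_nonlow t h htl
      by_cases htM : t < M + 1
      · rw [if_pos htM, if_pos htM, if_neg htl]
        by_cases htj : t < j' + 1
        · rw [if_pos htj, hship]; ring
        · rw [if_neg htj]; ring
      · rw [if_neg htM, if_neg htM, hμM t (by omega)]
        by_cases htj : t < j' + 1
        · rw [if_pos htj, hship]; ring
        · rw [if_neg htj]; ring
  · -- validity
    rintro (p | h) hpos
    · dsimp only [Sum.elim_inl] at hpos ⊢
      have hp : 0 < f p.1 p.2 := by
        by_contra hle
        have : f p.1 p.2 = 0 := le_antisymm (not_lt.1 hle) (hf0 _ _)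
        rw [this, zero_div] at hpos
        exact lt_irrefl _ hpos
      rw [if_pos hp, min_eq_left (hpair _ _ hp).1.le]
      obtain ⟨hlj, hl2, _, hc⟩ := hsupp _ _ hp
      by_cases hgi : j' + 1 ≤ (p.2 : ℕ)
      · simp only [gateOf, if_pos hgi]
        exact Or.inr (Or.inl ⟨(hpair _ _ hp).1, hgi, le_rfl⟩)
      · simp only [gateOf, if_neg hgi]
        refine Or.inr (Or.inr ⟨(hpair _ _ hp).1, by omega, hheavy _ _ hp hgi, ?_⟩)
        -- credit at the minimal gate: `pairGate ≥ ρ = (T − 2l)/(h − l)`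
        have hd : (0 : ℝ) < ((p.2 : ℕ) : ℝ) - ((p.1 : ℕ) : ℝ) := by
          have : ((p.1 : ℕ) : ℝ) < ((p.2 : ℕ) : ℝ) := by exact_mod_cast (hpair _ _ hp).1
          linarith
        have hρ : (T - 2 * ((p.1 : ℕ) : ℝ)) / (((p.2 : ℕ) : ℝ) - ((p.1 : ℕ) : ℝ)) ≤ pairGate x T (p.1 : ℕ) (p.2 : ℕ) :=
          le_max_left _ _
        rw [div_le_iff₀ hd] at hρ
        linarith
    · dsimp only [Sum.elim_inr] at hpos ⊢
      refine Or.inl ⟨rfl, ?_⟩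
      have hnl : ¬ ((h : ℕ) ≤ j' ∧ 2 * ((h : ℕ) : ℝ) < T) := by
        intro hl; rw [if_pos hl] at hpos; exact lt_irrefl _ hpos
      by_cases hj : j' + 1 ≤ (h : ℕ)
      · exact Or.inr hj
      · exact Or.inl (not_lt.1 fun hlt => hnl ⟨by omega, hlt⟩)


/-- **HEAVY FLOW ⟹ DEC SLICES**: for a law `μ` on `{0..M}` of mass `1` with a heavy flow at `(x, T, j′)` and a blob `(a ≥ 1, x ≤ g ≤ 1)`,
`slice μ a g` is DEC(j′) at target `T + a·g` on `{0..M+a}`. [this work] -/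
theorem slice_decAtT_of_hflowAtT (x T g : ℝ) (j' M a : ℕ) (μ : ℕ → ℝ) (hx0 : 0 < x) (hx1 : x < 1) (hxg : x ≤ g) (hg1 : g ≤ 1)
    (ha : 1 ≤ a) (hμM : ∀ h, M < h → μ h = 0) (hμ1 : ∑ h ∈ Finset.range (M + 1), μ h = 1) (h : HFlowAtT x T j' M μ) :
    DECAtT x (T + (a : ℝ) * g) j' (M + a) (slice μ a g) :=
  slice_decAtT_of_hdecAtT x T g j' M a μ hx0 hx1 hxg hg1 ha (hdecAtT_of_hflowAtT x T j' M μ hx0 hx1 hμM hμ1 h)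

/-- **CRITERION E AS A HEAVY FLOW.**  Law `μ ≥ 0` on `{0..M}`, floor `0 < x < 1`, target `T`, layer `j′`: if `x·P(low) ≤ (1−x)·P(giant)`
(low: `l ≤ j′`, `2l < T`; giant: `j′ < h ≤ M`) then the proportional flow into the giants, `f l h = μ l·μ h/P_G`, is a heavy flow (no mid
pair is used; when there is no low mass the zero flow works). [this work] -/
theorem hflowAtT_of_giantsAbsorbLows (x T : ℝ) (j' M : ℕ) (μ : ℕ → ℝ) (hx0 : 0 < x) (hx1 : x < 1) (hμ0 : ∀ h, 0 ≤ μ h)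
    (hE : x * ∑ l ∈ Finset.range (j' + 1), (if 2 * (l : ℝ) < T then μ l else 0)
      ≤ (1 - x) * ∑ h ∈ Finset.Ico (j' + 1) (M + 1), μ h) :
    HFlowAtT x T j' M μ := by
  classical
  set PL : ℝ := ∑ l ∈ Finset.range (j' + 1), (if 2 * (l : ℝ) < T then μ l else 0) with hPL
  set PG : ℝ := ∑ h ∈ Finset.Ico (j' + 1) (M + 1), μ h with hPG
  have hPL0 : 0 ≤ PL := Finset.sum_nonneg fun l _ => by split_ifs <;> [exact hμ0 l; exact le_rfl]
  have hPG0 : 0 ≤ PG := Finset.sum_nonneg fun h _ => hμ0 h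
  rcases hPG0.eq_or_lt with hPGz | hPGpos
  · -- no giant mass: then no low mass either; the zero flow
    have hPLz : PL = 0 := by
      have : x * PL ≤ 0 := by rw [← hPGz, mul_zero] at hE; exact hE
      nlinarith
    refine ⟨fun _ _ => 0, fun _ _ => le_rfl, fun l h hp => absurd hp (lt_irrefl _), fun l hlj hl2 => ?_, fun h _ _ => ?_,
      fun l h hp => absurd hp (lt_irrefl _)⟩
    · rw [Finset.sum_const_zero]
      have hle : μ l ≤ PL := by
        have := Finset.single_le_sum (f := fun l : ℕ => if 2 * (l : ℝ) < T then μ l else 0)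
          (fun l _ => by split_ifs <;> [exact hμ0 l; exact le_rfl]) (Finset.mem_range.2 (Nat.lt_succ_of_le hlj))
        simpa [if_pos hl2] using this
      linarith [hμ0 l]
    · simp only [mul_zero, Finset.sum_const_zero]; exact hμ0 h
  · -- proportional flow into the giants
    refine ⟨fun l h => if l ≤ j' ∧ 2 * (l : ℝ) < T ∧ j' + 1 ≤ h ∧ h ≤ M then μ l * μ h / PG else 0, ?_, ?_, ?_, ?_, ?_⟩
    · intro l h; dsimp only; split_ifs
      · exact div_nonneg (mul_nonneg (hμ0 l) (hμ0 h)) hPGpos.le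
      · exact le_rfl
    · intro l h hp; dsimp only at hp
      by_cases hc : l ≤ j' ∧ 2 * (l : ℝ) < T ∧ j' + 1 ≤ h ∧ h ≤ M
      · exact ⟨hc.1, hc.2.1, hc.2.2.2, Or.inl hc.2.2.1⟩
      · rw [if_neg hc] at hp; exact absurd hp (lt_irrefl _)
    · intro l hlj hl2; dsimp only
      have e : ∀ h ∈ Finset.range (M + 1), (if l ≤ j' ∧ 2 * (l : ℝ) < T ∧ j' + 1 ≤ h ∧ h ≤ M then μ l * μ h / PG else 0)
          = if h ∈ Finset.Ico (j' + 1) (M + 1) then μ l * μ h / PG else 0 := by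
        intro h hh
        have hhM : h ≤ M := Nat.lt_succ_iff.1 (Finset.mem_range.1 hh)
        by_cases hj : j' + 1 ≤ h
        · rw [if_pos ⟨hlj, hl2, hj, hhM⟩, if_pos (Finset.mem_Ico.2 ⟨hj, by omega⟩)]
        · rw [if_neg (fun hc => hj hc.2.2.1), if_neg (fun hm => hj (Finset.mem_Ico.1 hm).1)]
      rw [Finset.sum_congr rfl e, ← Finset.sum_filter]
      have hf : (Finset.range (M + 1)).filter (fun h => h ∈ Finset.Ico (j' + 1) (M + 1)) = Finset.Ico (j' + 1) (M + 1) := by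
        ext h; simp only [Finset.mem_filter, Finset.mem_range, Finset.mem_Ico]; omega
      rw [hf]
      have : ∑ h ∈ Finset.Ico (j' + 1) (M + 1), μ l * μ h / PG = μ l * PG / PG := by
        rw [hPG, Finset.mul_sum, Finset.sum_div]
      rw [this, mul_div_assoc, div_self hPGpos.ne', mul_one]
    · intro h hhM hnl; dsimp only
      by_cases hj : j' + 1 ≤ h
      · -- a giant: load = (x/(1−x))·μ h·PL/PG ≤ μ h
        simp only [usage, gateOf, if_pos hj]
        have e : ∀ l ∈ Finset.range (j' + 1),
            x / (1 - x) * (if l ≤ j' ∧ 2 * (l : ℝ) < T ∧ j' + 1 ≤ h ∧ h ≤ M then μ l * μ h / PG else 0)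
              = (x / (1 - x) * (μ h / PG)) * (if 2 * (l : ℝ) < T then μ l else 0) := by
          intro l hl
          have hlj : l ≤ j' := Nat.lt_succ_iff.1 (Finset.mem_range.1 hl)
          by_cases hl2 : 2 * (l : ℝ) < T
          · rw [if_pos ⟨hlj, hl2, hj, hhM⟩, if_pos hl2]; ring
          · rw [if_neg (fun hc => hl2 hc.2.1), if_neg hl2]; ring
        rw [Finset.sum_congr rfl e, ← Finset.mul_sum, ← hPL]
        have h1x : 0 < 1 - x := by linarith
        rw [show x / (1 - x) * (μ h / PG) * PL = μ h * (x * PL) / ((1 - x) * PG) by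
          field_simp]
        rw [div_le_iff₀ (mul_pos h1x hPGpos)]
        have := mul_le_mul_of_nonneg_left hE (hμ0 h)
        nlinarith [this]
      · -- a mid: no flow arrives
        have : ∑ l ∈ Finset.range (j' + 1), usage x T j' l h *
            (if l ≤ j' ∧ 2 * (l : ℝ) < T ∧ j' + 1 ≤ h ∧ h ≤ M then μ l * μ h / PG else 0) = 0 :=
          Finset.sum_eq_zero fun l _ => by rw [if_neg (fun hc => hj hc.2.2.1), mul_zero]
        rw [this]; exact hμ0 h
    · intro l h hp hj; dsimp only at hp
      rw [if_neg (fun hc => hj hc.2.2.1)] at hp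
      exact absurd hp (lt_irrefl _)

/-- **CRITERION E ⟹ DEC SLICES.**  If `μ ≥ 0` on `{0..M}` (mass `1`) satisfies criterion E at `(x, T, j′)` then for every blob
`(a ≥ 1, x ≤ g ≤ 1)` the slice is DEC(j′) at target `T + a·g`: Conjecture SL's conclusion from the layer-`j′` inequality alone. [this work] -/
theorem slice_decAtT_of_giantsAbsorbLows (x T g : ℝ) (j' M a : ℕ) (μ : ℕ → ℝ) (hx0 : 0 < x) (hx1 : x < 1) (hxg : x ≤ g)
    (hg1 : g ≤ 1) (ha : 1 ≤ a) (hμ0 : ∀ h, 0 ≤ μ h) (hμM : ∀ h, M < h → μ h = 0)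
    (hμ1 : ∑ h ∈ Finset.range (M + 1), μ h = 1)
    (hE : x * ∑ l ∈ Finset.range (j' + 1), (if 2 * (l : ℝ) < T then μ l else 0)
      ≤ (1 - x) * ∑ h ∈ Finset.Ico (j' + 1) (M + 1), μ h) :
    DECAtT x (T + (a : ℝ) * g) j' (M + a) (slice μ a g) :=
  slice_decAtT_of_hflowAtT x T g j' M a μ hx0 hx1 hxg hg1 ha hμM hμ1 (hflowAtT_of_giantsAbsorbLows x T j' M μ hx0 hx1 hμ0 hE)

end LawDec

end Quant

end Summit.CriticalPhenomena.PercolationContinuityZ3.Theorems
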